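import Summits.AtomisticToContinuum.Crystallization.Theorems.ChessboardParticlePlanesPeriodicWindowsStubOffsetLayerDecay

/-!
# Crux `PeriodicWindows` (stmt-AtomisticToContinuum-3240), line `dense-laminar-hull` — stub HC, helper
# `hc_layerSum_mono`: the general-offset Lennard-Jones layer sum is increasing in the height `|H|`

For the triangular layer lattice `{i v₁(a) + j v₂(a)}` (`a ≥ 7/10`), a HORIZONTAL offset `θ` (`θ 2 = 0`) and heights
`7/10 ≤ |H| ≤ |H'|`, if every distance `‖i v₁ + j v₂ + θ + H e₃‖` is at least `1`, then
`∑' V_LJ ‖i v₁ + j v₂ + θ + H e₃‖ ≤ ∑' V_LJ ‖i v₁ + j v₂ + θ + H' e₃‖`.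

Route: termwise, Pythagoras (`gsc_norm_sq_horiz_add`, `old_norm_sq_horiz`) gives
`‖ℓ + θ + H e₃‖² = ‖ℓ + θ‖² + H² ≤ ‖ℓ + θ‖² + H'² = ‖ℓ + θ + H' e₃‖²`, so both distances are `≥ 1` and `V_LJ`, which is
increasing on `[1, ∞)` (`Literature.Barriers.AtomisticToContinuum.strictMonoOn_lennardJones`), compares the terms; both
families are summable by `stub_offsetLayerDecay` (absolute summability for `|H|, |H'| ≥ 7/10`), so `tsum_le_tsum`
applies. All elementary. [folklore]
-/

noncomputable section

namespace Summit.AtomisticToContinuum.Crystallization.Theorems.PeriodicWindowsDenseLaminarHull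

open Literature.MathematicalPhysics.StatisticalMechanics Filter Metric
open scoped BigOperators

/-- **Termwise distance comparison**: for horizontal `θ` and `|H| ≤ |H'|`, the point `i v₁ + j v₂ + θ + H e₃` is no
farther from the origin than `i v₁ + j v₂ + θ + H' e₃` (Pythagoras). [folklore] -/
theorem hcm_norm_le {a : ℝ} (ha : a ≠ 0) (θ : EuclideanSpace ℝ (Fin 3)) (hθ : θ 2 = 0) {H H' : ℝ}
    (hHH' : |H| ≤ |H'|) (i j : ℝ) :
    ‖i • triangularVec₁ a + j • triangularVec₂ a + θ + H • layerNormal 1‖ ≤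
      ‖i • triangularVec₁ a + j • triangularVec₂ a + θ + H' • layerNormal 1‖ := by
  have h2 := (old_norm_sq_horiz ha θ hθ i j).1
  have e := gsc_norm_sq_horiz_add _ h2 H
  have e' := gsc_norm_sq_horiz_add _ h2 H'
  have hsq : H ^ 2 ≤ H' ^ 2 := by
    rw [← sq_abs, ← sq_abs H']
    exact pow_le_pow_left₀ (abs_nonneg _) hHH' 2
  refine (pow_le_pow_iff_left₀ (norm_nonneg _) (norm_nonneg _) two_ne_zero).1 ?_
  rw [e, e']
  linarith

/-- **Stub HC helper `hc_layerSum_mono`.** For `a ≥ 7/10`, a horizontal offset `θ` and heights `7/10 ≤ |H| ≤ |H'|`: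
if every distance `‖i v₁ + j v₂ + θ + H e₃‖` (`(i,j) ∈ ℤ²`) is at least `1`, then the Lennard-Jones layer sum at height
`H` is at most the one at height `H'` (termwise monotonicity of `V_LJ` on `[1, ∞)` and summability of both families
from `stub_offsetLayerDecay`). [folklore] -/
theorem hc_layerSum_mono : ∀ a : ℝ, (7 : ℝ) / 10 ≤ a → ∀ θ : EuclideanSpace ℝ (Fin 3), θ 2 = 0 →
    ∀ H H' : ℝ, (7 : ℝ) / 10 ≤ |H| → |H| ≤ |H'| →
    (∀ ij : ℤ × ℤ, 1 ≤ ‖((ij.1 : ℝ)) • triangularVec₁ a + ((ij.2 : ℝ)) • triangularVec₂ a + θ + H • layerNormal 1‖) →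
    (∑' ij : ℤ × ℤ, lennardJones ‖((ij.1 : ℝ)) • triangularVec₁ a + ((ij.2 : ℝ)) • triangularVec₂ a + θ +
        H • layerNormal 1‖) ≤
      ∑' ij : ℤ × ℤ, lennardJones ‖((ij.1 : ℝ)) • triangularVec₁ a + ((ij.2 : ℝ)) • triangularVec₂ a + θ +
        H' • layerNormal 1‖ := by
  intro a ha θ hθ H H' hH hHH' hone
  have ha0 : 0 < a := by linarith
  have hH' : (7 : ℝ) / 10 ≤ |H'| := hH.trans hHH'
  obtain ⟨-, C, hC⟩ := stub_offsetLayerDecay a ha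
  have hsH := (summable_abs_iff.1 (hC H θ hθ hH).1)
  have hsH' := (summable_abs_iff.1 (hC H' θ hθ hH').1)
  refine hsH.tsum_le_tsum (fun ij => ?_) hsH'
  have hle := hcm_norm_le ha0.ne' θ hθ hHH' (ij.1 : ℝ) (ij.2 : ℝ)
  exact Literature.Barriers.AtomisticToContinuum.strictMonoOn_lennardJones.monotoneOn
    (Set.mem_Ici.2 (hone ij)) (Set.mem_Ici.2 ((hone ij).trans hle)) hle

end Summit.AtomisticToContinuum.Crystallization.Theorems.PeriodicWindowsDenseLaminarHull

end
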